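import Summits.QuantumFields.YangMills.Theorems.BalabanUVNodesK2Line2FirstRungsAtScaleZero
import Mathlib.Order.Filter.Pi

/-!
# Crux K2⁷ `EndpointGivenBR13SepCoPH`, LINE 2 «shift-cauchy-everyslope» — THE RUNGS S2 (`stub_anchor13 : D4AnchorRecord13`) AND S3 (`stub_cont13 : ContRecord13`) IN KERNEL FORM AT
# EVERY SCALE `k`: S2_k ⟺ «the merged β-function `β_m k` tends to the path-limit number `β⁰_k` along the PRODUCT of one-sided neighbourhood filters at the corner of `]0, γ]^{k+1}`»;
# S3_k ⟺ «`β_m k` is continuous on the box `]0, θ.γ]^{k+1}`» (successor of g0's `…K2Line2FirstRungsAtScaleZero`, the `k = 0` rungs)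

Cell `pub-ymgap`, YM-PLAN Track A (HUMAN RULING D-0062 ∕ D-0149, director-ym №197), WIDTH SEAT `pub-ymgap-dag-n13-w4` (g2) on NODE n13 [Balaban1989LargeFieldII]; helper
(`--supports stmt-QuantumFields-20543 --as helper`) for crux K2⁷ `EndpointGivenBR13SepCoPH` (skeleton of record v4 e802584ecf0c3a42 `D81-K2V4/K2Skeleton13SepCoPHv4.lean`, LINE 2
§L2.3: registered private stubs `stub_anchor13 : D4AnchorRecord13` (S2 «per-scale anchor», `AnchorVanishing` of the record's definitional split: ∀ k δ>0 ∃ γ>0, |β¹_k| ≤ δ on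
`]0,γ]^{k+1}`) and `stub_cont13 : ContRecord13` (S3 «box continuity», `BetaContH θ.γ` of the β of record); texts unchanged v3 → v4).  COUNT-NEUTRAL; NOT a proof of either stub.

WHAT THE RUNGS SAY, SCALE BY SCALE.  The record's β is `betaOfMerged β_m β⁰ θ.γ` (`= β_m` ON the box `]0, θ.γ]^{k+1}`, `= β⁰_k` OFF it; `Node00/BetaOfRecord`), its definitional split
has remainder `S.β1 k v = 𝟙_{]0,θ.γ]^{k+1}}(v)·(β_m k v − β⁰ k)` (`rfl`) with the one-loop number `β⁰ k := beta0OfMerged β_m θ.v₀ k = limUnder_{g→0⁺} β_m k (θ.v₀ k with last entry g)`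
— a PATH limit at the reference history `θ.v₀ k`.  Hence, at every scale `k` (g0 did `k = 0`, where the box is an interval and the path is the only approach):
* S2_k (the anchor at scale `k`) ⟺ `Tendsto (β_m k) (Filter.pi fun _ : Fin (k+1) => 𝓝[>] 0) (𝓝 (β⁰ k))` — the merged β-function has a JOINT limit at the corner `0` of the positive
  orthant (all `k+1` couplings → 0⁺ together, the boxes `]0,γ]^{k+1}` being a basis of that product filter) AND that limit is the path-limit NUMBER `β⁰_k`.  For `k ≥ 1` the two
  clauses are distinct: print's (2.13) «vanishes at g_k = 0» for EVERY earlier history, plus the history-independence of the coupling-free `log Z^{(k)}` number, give both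
  ([Balaban1987RG1] (2.12)–(2.14) p. 268; NODE O); the tree asserts neither.
* S3_k ⟺ `ContinuousOn (β_m k) (]0, θ.γ]^{k+1})` (the record's β IS `β_m` on the box; `ContinuousOn.congr`).
* S2 ∧ «the joint limit exists with SOME value `L_k`» does NOT by itself pin `L_k = β⁰_k` when `k ≥ 1` (the path of `β⁰_k` leaves every small box unless the reference history is
  small) — recorded as the explicit two-clause form `anchorAt_iff_exists_tendsto_pi_and_eq`.

WHAT THIS FILE PROVES (theorems only, 0 `def`, 0 `sorry`; flow side generic in `(β_m, β⁰, γθ)`, then the record's objects, general `N` and the `N = 2` texts).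
* §1 flow side: `box_mem_pi_nhdsGT` (the boxes `]0,γ]^{k+1}` belong to the product filter) · `exists_box_subset_of_mem_pi_nhdsGT` (and form a basis of it) · `betaOne_apply` (face) ·
  ★★ `anchorAt_betaOfMerged_iff_tendsto_pi` (S2_k ⟺ joint corner limit `= β⁰ k`) · `anchorAt_iff_exists_tendsto_pi_and_eq` · ★ `anchor_betaOfMerged_iff_forall_tendsto_pi` (all scales) ·
  ★ `betaContH_betaOfMerged_iff_continuousOn` (S3 ⟺ ∀ k, `ContinuousOn (β_m k) (Box γθ k)`).
* §2 at the record (`θ : Stage13HParams F N`, `0 < θ.γ`): ★★ `anchorAt_record_iff_tendsto_pi` · `anchor_record_iff_forall_tendsto_pi` · ★ `cont_record_iff_forall_continuousOn` ·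
  consistency with g0's `k = 0` rung: `tendsto_pi_zero_iff_tendsto_nhdsGT` (at `k = 0` the product filter IS `𝓝[>] 0` read through `Fin 1 → ℝ`).
* §3 `N = 2`: the registered texts' per-`(F, θ, hP)` bodies ⟺ the kernel forms (`anchorRecord13Body₂_iff`, `contRecord13Body₂_iff`).

HONEST SCOPE (A6, №189).  Elementary filter∕topology bookkeeping (product filters on `Fin (k+1) → ℝ`, indicator faces); both sides of every `iff` are analytic statements about
Bałaban's merged β-functions that the tree does NOT prove (NODE O ∕ K2⁷ line 2); nothing is discharged; `(θ, hP : θ.Provisos₁₃SepCoPH F N)` is inhabited iff K0⁷ (open crux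
stmt-QuantumFields-20541).  NOT a proof of `stub_anchor13` ∕ `stub_cont13`; K2⁷ ∕ K1⁷ NOT closed; N13 ∕ N25 ∕ N26 NOT discharged; counts unmoved (typed 28∕28 · discharged 5∕27 ·
A 5∕28).  One finite four-torus programme at fixed `ε = L^{−K}`, Bałaban AS PRINTED; the YM mass gap (Clay) is NOT proved by any of this — R4 closes the conditional finite-𝕋⁴ rung
`BalabanLadder.UV` only; nothing continuum ∕ ℝ⁴ ∕ OS.  No `def`, no `instance`, no `notation`, no `axiom`.
References: [I] = [Balaban1987RG1] CMP **109** (1987): (1.20)–(1.22) p. 264, (2.12)–(2.14) p. 268; [II] = [Balaban1988RG2Cluster] CMP **116** (1988): Lemma 3 (2.38) p. 20.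
-/

noncomputable section

open scoped Matrix.Norms.L2Operator

namespace Summit.QuantumFields.YangMills.Theorems.BalabanUVNodesK2Line2RungsAllScales

open Literature.MathematicalPhysics.QuantumFieldTheory.Balaban1983to89
open Literature.MathematicalPhysics.QuantumFieldTheory.Balaban1983to89.FlowStep
open Literature.MathematicalPhysics.QuantumFieldTheory.Balaban1983to89.FlowStepRuns
open Literature.MathematicalPhysics.QuantumFieldTheory.Balaban1983to89.T4Continuum (T4Family FiniteEpsData)
open Literature.MathematicalPhysics.QuantumFieldTheory.Balaban1983to89.Node00
open Filter Topology

/-! ## §1. Flow side: the anchor at scale `k` is a joint corner limit equal to the path-limit number; box continuity is continuity of `β_m` on the box -/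

section Flow

/-- **The boxes belong to the product of one-sided neighbourhood filters**: for `γ > 0`, `]0, γ]^{k+1} ∈ Filter.pi (fun _ : Fin (k+1) => 𝓝[>] 0)`. [folklore] -/
theorem box_mem_pi_nhdsGT {γ : ℝ} (hγ : 0 < γ) (k : ℕ) :
    Box γ k ∈ Filter.pi (fun _ : Fin (k + 1) => 𝓝[>] (0 : ℝ)) := by
  have h : ∀ _i : Fin (k + 1), ∀ᶠ x in 𝓝[>] (0 : ℝ), 0 < x ∧ x ≤ γ := fun _ => by
    have hlt : ∀ᶠ x in 𝓝[>] (0 : ℝ), x < γ := (eventually_lt_nhds hγ).filter_mono nhdsWithin_le_nhds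
    have hpos : ∀ᶠ x in 𝓝[>] (0 : ℝ), 0 < x := eventually_mem_nhdsWithin
    filter_upwards [hlt, hpos] with x hx hx0
    exact ⟨hx0, hx.le⟩
  have hev := Filter.eventually_pi h
  refine Filter.mem_of_superset hev fun v hv => ?_
  rw [mem_box]
  exact hv

/-- **… and form a basis of it**: every member of `Filter.pi (fun _ : Fin (k+1) => 𝓝[>] 0)` contains a box `]0, γ]^{k+1}`, `γ > 0`. [folklore] -/
theorem exists_box_subset_of_mem_pi_nhdsGT {k : ℕ} {S : Set (Fin (k + 1) → ℝ)} (hS : S ∈ Filter.pi (fun _ : Fin (k + 1) => 𝓝[>] (0 : ℝ))) :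
    ∃ γ : ℝ, 0 < γ ∧ Box γ k ⊆ S := by
  obtain ⟨I, -, t, ht, hsub⟩ := Filter.mem_pi.mp hS
  choose u hu hut using fun i => mem_nhdsGT_iff_exists_Ioo_subset.mp (ht i)
  have hu0 : ∀ i, (0 : ℝ) < u i := fun i => hu i
  set γ : ℝ := (Finset.univ.inf' Finset.univ_nonempty u) / 2 with hγ
  have hγu : ∀ i, γ < u i := fun i => by
    have h1 : Finset.univ.inf' Finset.univ_nonempty u ≤ u i := Finset.inf'_le _ (Finset.mem_univ i)
    have h2 : 0 < u i := hu0 i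
    rw [hγ]; linarith
  have hγ0 : 0 < γ := by
    have : 0 < Finset.univ.inf' Finset.univ_nonempty u := (Finset.lt_inf'_iff _).mpr fun i _ => hu0 i
    rw [hγ]; linarith
  refine ⟨γ, hγ0, fun v hv => hsub fun i _ => hut i ⟨(mem_box.mp hv i).1, lt_of_le_of_lt (mem_box.mp hv i).2 (hγu i)⟩⟩

/-- FACE: the remainder of the definitional split of `betaOfMerged βm β0 γθ` at scale `k` is `𝟙_{]0,γθ]^{k+1}}(v)·(βm k v − β0 k)` (`Node00.oneLoopSplit_betaOfMerged`, `rfl`).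
[cite: Balaban1987RG1, (2.12)–(2.14) p.268 (bookkeeping)] -/
theorem betaOne_apply (βm : HBeta) (β0 : ℕ → ℝ) (γθ : ℝ) (k : ℕ) (v : Fin (k + 1) → ℝ) :
    (oneLoopSplit_betaOfMerged βm β0 γθ).β1 k v = (Box γθ k).indicator (fun w => βm k w - β0 k) v :=
  rfl

/-- ★★ **THE ANCHOR AT SCALE `k` ⟺ THE MERGED β-FUNCTION TENDS TO THE PATH-LIMIT NUMBER ALONG THE PRODUCT FILTER AT THE CORNER** (`0 < γθ`):
«∀ δ > 0, ∃ γ > 0, ∀ v ∈ ]0,γ]^{k+1}, |S.β1 k v| ≤ δ» for the split of `betaOfMerged βm β0 γθ` ⟺ `Tendsto (βm k) (Filter.pi fun _ => 𝓝[>] 0) (𝓝 (β0 k))` (below `min γ γθ` the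
remainder IS `βm k v − β0 k`; the boxes are a basis of the product filter). [cite: Balaban1987RG1, (2.12)–(2.14) p.268 («vanishes at g_k = 0», scale by scale; elementary reformulation)] -/
theorem anchorAt_betaOfMerged_iff_tendsto_pi (βm : HBeta) (β0 : ℕ → ℝ) {γθ : ℝ} (hγθ : 0 < γθ) (k : ℕ) :
    (∀ δ : ℝ, 0 < δ → ∃ γ : ℝ, 0 < γ ∧ ∀ v ∈ Box γ k, |(oneLoopSplit_betaOfMerged βm β0 γθ).β1 k v| ≤ δ) ↔
      Tendsto (βm k) (Filter.pi fun _ : Fin (k + 1) => 𝓝[>] (0 : ℝ)) (𝓝 (β0 k)) := by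
  constructor
  · intro h
    rw [Metric.tendsto_nhds]
    intro ε hε
    obtain ⟨γ, hγ, hA⟩ := h (ε / 2) (half_pos hε)
    filter_upwards [box_mem_pi_nhdsGT (lt_min hγ hγθ) k] with v hv
    have hvγ : v ∈ Box γ k := box_mono (min_le_left _ _) k hv
    have hvθ : v ∈ Box γθ k := box_mono (min_le_right _ _) k hv
    have hb := hA v hvγ
    rw [betaOne_apply, Set.indicator_of_mem hvθ] at hb
    rw [Real.dist_eq]
    exact lt_of_le_of_lt hb (half_lt_self hε)
  · intro h δ hδ
    have hS : {v : Fin (k + 1) → ℝ | dist (βm k v) (β0 k) < δ} ∈ Filter.pi (fun _ : Fin (k + 1) => 𝓝[>] (0 : ℝ)) :=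
      Metric.tendsto_nhds.mp h δ hδ
    obtain ⟨γ, hγ, hsub⟩ := exists_box_subset_of_mem_pi_nhdsGT hS
    refine ⟨min γ γθ, lt_min hγ hγθ, fun v hv => ?_⟩
    have hvγ : v ∈ Box γ k := box_mono (min_le_left _ _) k hv
    have hvθ : v ∈ Box γθ k := box_mono (min_le_right _ _) k hv
    rw [betaOne_apply, Set.indicator_of_mem hvθ]
    have hd : dist (βm k v) (β0 k) < δ := hsub hvγ
    rw [Real.dist_eq] at hd
    exact hd.le

/-- **The two clauses of the anchor made explicit**: the anchor at scale `k` ⟺ «SOME joint corner limit `L` of `βm k` exists AND `L` is the path-limit number `β0 k`» — for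
`k ≥ 1` genuinely two conditions (the path defining `β⁰_k` leaves every small box unless the reference history is small). [cite: Balaban1987RG1, (2.12)–(2.14) p.268 (elementary reformulation)] -/
theorem anchorAt_iff_exists_tendsto_pi_and_eq (βm : HBeta) (β0 : ℕ → ℝ) {γθ : ℝ} (hγθ : 0 < γθ) (k : ℕ) :
    (∀ δ : ℝ, 0 < δ → ∃ γ : ℝ, 0 < γ ∧ ∀ v ∈ Box γ k, |(oneLoopSplit_betaOfMerged βm β0 γθ).β1 k v| ≤ δ) ↔
      ∃ L : ℝ, Tendsto (βm k) (Filter.pi fun _ : Fin (k + 1) => 𝓝[>] (0 : ℝ)) (𝓝 L) ∧ L = β0 k := by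
  rw [anchorAt_betaOfMerged_iff_tendsto_pi βm β0 hγθ k]
  exact ⟨fun h => ⟨β0 k, h, rfl⟩, fun ⟨L, hL, hLe⟩ => hLe ▸ hL⟩

/-- ★ **ALL SCALES**: the anchor property of the split of `betaOfMerged βm β0 γθ` (the text of K2⁷ v4's `AnchorVanishing`, spelled out) ⟺ at EVERY scale the merged β-function
tends to `β0 k` along the product filter at the corner. [cite: Balaban1987RG1, (2.12)–(2.14) p.268 (elementary reformulation)] -/
theorem anchor_betaOfMerged_iff_forall_tendsto_pi (βm : HBeta) (β0 : ℕ → ℝ) {γθ : ℝ} (hγθ : 0 < γθ) :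
    (∀ k : ℕ, ∀ δ : ℝ, 0 < δ → ∃ γ : ℝ, 0 < γ ∧ ∀ v ∈ Box γ k, |(oneLoopSplit_betaOfMerged βm β0 γθ).β1 k v| ≤ δ) ↔
      ∀ k : ℕ, Tendsto (βm k) (Filter.pi fun _ : Fin (k + 1) => 𝓝[>] (0 : ℝ)) (𝓝 (β0 k)) :=
  forall_congr' fun k => anchorAt_betaOfMerged_iff_tendsto_pi βm β0 hγθ k

/-- ★ **BOX CONTINUITY OF THE β OF RECORD ⟺ CONTINUITY OF THE MERGED β ON THE BOXES**: `BetaContH γθ (betaOfMerged βm β0 γθ) ↔ ∀ k, ContinuousOn (βm k) (Box γθ k)` (the two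
functions agree ON the box; `ContinuousOn.congr`). [cite: Balaban1987RG1, §1 p.264 (β-clause; elementary reformulation)] -/
theorem betaContH_betaOfMerged_iff_continuousOn (βm : HBeta) (β0 : ℕ → ℝ) (γθ : ℝ) :
    BetaContH γθ (betaOfMerged βm β0 γθ) ↔ ∀ k : ℕ, ContinuousOn (βm k) (Box γθ k) := by
  refine forall_congr' fun k => ?_
  have heq : Set.EqOn (betaOfMerged βm β0 γθ k) (βm k) (Box γθ k) := fun v hv => betaOfMerged_of_mem βm β0 γθ hv
  exact ⟨fun h => h.congr fun v hv => (heq hv).symm, fun h => h.congr heq⟩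

/-- **Consistency with g0's `k = 0` rung**: on `Fin 1 → ℝ` the product filter of `𝓝[>] 0` is `𝓝[>] 0` read through the constant histories — `Tendsto (βm 0) (Filter.pi fun _ => 𝓝[>] 0)
(𝓝 b) ↔ Tendsto (g ↦ βm 0 (g)) (𝓝[>] 0) (𝓝 b)`. [folklore] -/
theorem tendsto_pi_zero_iff_tendsto_nhdsGT (βm : HBeta) (b : ℝ) :
    Tendsto (βm 0) (Filter.pi fun _ : Fin (0 + 1) => 𝓝[>] (0 : ℝ)) (𝓝 b) ↔
      Tendsto (fun g : ℝ => βm 0 (fun _ => g)) (𝓝[>] (0 : ℝ)) (𝓝 b) := by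
  have hconst : ∀ v : Fin (0 + 1) → ℝ, (fun _ : Fin (0 + 1) => v 0) = v := fun v => by
    funext i; rw [Subsingleton.elim (α := Fin 1) i 0]
  constructor
  · intro h
    have hc : Tendsto (fun g : ℝ => (fun _ : Fin (0 + 1) => g)) (𝓝[>] (0 : ℝ)) (Filter.pi fun _ : Fin (0 + 1) => 𝓝[>] (0 : ℝ)) :=
      tendsto_pi.mpr fun _ => tendsto_id
    exact h.comp hc
  · intro h
    rw [Metric.tendsto_nhds] at h ⊢
    intro ε hε
    have hev := h ε hε
    obtain ⟨U, hU, hsubU⟩ : ∃ U ∈ 𝓝[>] (0 : ℝ), ∀ g ∈ U, dist (βm 0 (fun _ => g)) b < ε := ⟨_, hev, fun _ hg => hg⟩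
    have hpi : Set.pi Set.univ (fun _ : Fin (0 + 1) => U) ∈ Filter.pi (fun _ : Fin (0 + 1) => 𝓝[>] (0 : ℝ)) :=
      pi_mem_pi Set.finite_univ fun _ _ => hU
    filter_upwards [hpi] with v hv
    have h0 : v 0 ∈ U := hv 0 (Set.mem_univ _)
    have := hsubU (v 0) h0
    rwa [hconst v] at this

end Flow

/-! ## §2. At NODE 00's Stage-13 record: S2 and S3 of K2⁷ v4 LINE 2, scale by scale and at all scales -/

section Record

variable {F : T4Family} {N : ℕ} [NeZero N]

/-- ★★ **S2 AT SCALE `k` ⟺ THE MERGED β-FUNCTION OF RECORD TENDS TO ITS ONE-LOOP NUMBER ALONG THE PRODUCT FILTER AT THE CORNER** (`0 < θ.γ`): the scale-`k` clause of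
`D4AnchorRecord13`'s body at `(F, θ, hP)` ⟺ `Tendsto (β_m k) (Filter.pi fun _ => 𝓝[>] 0) (𝓝 (beta0OfMerged β_m θ.v₀ k))` — all `k+1` couplings → 0⁺ jointly, the limit being the
PATH-limit number at the reference history `θ.v₀ k` ([I] (2.13) «vanishes at g_k = 0» for every earlier history + history-independence of the `log Z^{(k)}` number; NODE O).
[cite: Balaban1987RG1, (2.12)–(2.14) p.268 and (1.22) p.264 (elementary reformulation)] -/
theorem anchorAt_record_iff_tendsto_pi (θ : Stage13HParams F N) (hγθ : 0 < θ.γ) (k : ℕ) :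
    letI := θ.instVβ₁; letI := θ.instVβ₂; letI := θ.instιβ
    (∀ δ : ℝ, 0 < δ → ∃ γ : ℝ, 0 < γ ∧ ∀ v ∈ Box γ k,
        |(oneLoopSplit_betaOfMerged (betaMerged F (mergedTermFamilyMatT F N (TcanOfRecord F N) (chiFixed29 F N θ.ν θ.ε₂₉) θ.εbg) θ.ρ8 θ.bV)
            (beta0OfMerged (betaMerged F (mergedTermFamilyMatT F N (TcanOfRecord F N) (chiFixed29 F N θ.ν θ.ε₂₉) θ.εbg) θ.ρ8 θ.bV) θ.v₀) θ.γ).β1 k v| ≤ δ) ↔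
      Tendsto (betaMerged F (mergedTermFamilyMatT F N (TcanOfRecord F N) (chiFixed29 F N θ.ν θ.ε₂₉) θ.εbg) θ.ρ8 θ.bV k)
        (Filter.pi fun _ : Fin (k + 1) => 𝓝[>] (0 : ℝ))
        (𝓝 (beta0OfMerged (betaMerged F (mergedTermFamilyMatT F N (TcanOfRecord F N) (chiFixed29 F N θ.ν θ.ε₂₉) θ.εbg) θ.ρ8 θ.bV) θ.v₀ k)) := by
  letI := θ.instVβ₁; letI := θ.instVβ₂; letI := θ.instιβ
  exact anchorAt_betaOfMerged_iff_tendsto_pi _ _ hγθ k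

/-- **S2 AT ALL SCALES** (`0 < θ.γ`): `D4AnchorRecord13`'s body at `(F, θ, hP)` (spelled out) ⟺ ∀ k, the product-filter limit at the corner equals the one-loop number.
[cite: Balaban1987RG1, (2.12)–(2.14) p.268 (elementary reformulation)] -/
theorem anchor_record_iff_forall_tendsto_pi (θ : Stage13HParams F N) (hγθ : 0 < θ.γ) :
    letI := θ.instVβ₁; letI := θ.instVβ₂; letI := θ.instιβ
    (∀ k : ℕ, ∀ δ : ℝ, 0 < δ → ∃ γ : ℝ, 0 < γ ∧ ∀ v ∈ Box γ k,
        |(oneLoopSplit_betaOfMerged (betaMerged F (mergedTermFamilyMatT F N (TcanOfRecord F N) (chiFixed29 F N θ.ν θ.ε₂₉) θ.εbg) θ.ρ8 θ.bV)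
            (beta0OfMerged (betaMerged F (mergedTermFamilyMatT F N (TcanOfRecord F N) (chiFixed29 F N θ.ν θ.ε₂₉) θ.εbg) θ.ρ8 θ.bV) θ.v₀) θ.γ).β1 k v| ≤ δ) ↔
      ∀ k : ℕ, Tendsto (betaMerged F (mergedTermFamilyMatT F N (TcanOfRecord F N) (chiFixed29 F N θ.ν θ.ε₂₉) θ.εbg) θ.ρ8 θ.bV k)
        (Filter.pi fun _ : Fin (k + 1) => 𝓝[>] (0 : ℝ))
        (𝓝 (beta0OfMerged (betaMerged F (mergedTermFamilyMatT F N (TcanOfRecord F N) (chiFixed29 F N θ.ν θ.ε₂₉) θ.εbg) θ.ρ8 θ.bV) θ.v₀ k)) := by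
  letI := θ.instVβ₁; letI := θ.instVβ₂; letI := θ.instιβ
  exact anchor_betaOfMerged_iff_forall_tendsto_pi _ _ hγθ

/-- ★ **S3 ⟺ THE MERGED β OF RECORD IS CONTINUOUS ON EVERY BOX `]0, θ.γ]^{k+1}`** (no hypothesis): `ContRecord13`'s body at `(F, θ, hP)` ⟺ `∀ k, ContinuousOn (β_m k) (Box θ.γ k)`
(g0's `contZero_iff_continuousOn_Ioc` is `k = 0` read through `Fin 1 → ℝ ≃ ℝ`). [cite: Balaban1987RG1, §1 p.264 (β-clause; elementary reformulation)] -/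
theorem cont_record_iff_forall_continuousOn (θ : Stage13HParams F N) :
    letI := θ.instVβ₁; letI := θ.instVβ₂; letI := θ.instιβ
    BetaContH θ.γ
        (betaOfMerged (betaMerged F (mergedTermFamilyMatT F N (TcanOfRecord F N) (chiFixed29 F N θ.ν θ.ε₂₉) θ.εbg) θ.ρ8 θ.bV)
          (beta0OfMerged (betaMerged F (mergedTermFamilyMatT F N (TcanOfRecord F N) (chiFixed29 F N θ.ν θ.ε₂₉) θ.εbg) θ.ρ8 θ.bV) θ.v₀) θ.γ) ↔
      ∀ k : ℕ, ContinuousOn (betaMerged F (mergedTermFamilyMatT F N (TcanOfRecord F N) (chiFixed29 F N θ.ν θ.ε₂₉) θ.εbg) θ.ρ8 θ.bV k) (Box θ.γ k) := by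
  letI := θ.instVβ₁; letI := θ.instVβ₂; letI := θ.instιβ
  exact betaContH_betaOfMerged_iff_continuousOn _ _ _

end Record

/-! ## §3. `N = 2`: the registered texts' bodies (K2⁷ v4 §L2.3, `D4AnchorRecord13` ∕ `ContRecord13`, per `(F, θ, hP)` under admissibility) in kernel form -/

section Two

variable {F : T4Family}

/-- `N = 2`: the body of `D4AnchorRecord13` at an admissible `(F, θ, hP)` ⟺ ∀ k, `β_m k → β⁰_k` along the product filter at the corner (`0 < θ.γ` from admissibility).
[cite: Balaban1987RG1, (2.12)–(2.14) p.268 (elementary reformulation)] -/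
theorem anchorRecord13Body₂_iff (θ : Stage13HParams F 2) (hθ : θ.Admissible F 2) :
    letI := θ.instVβ₁; letI := θ.instVβ₂; letI := θ.instιβ
    (∀ k : ℕ, ∀ δ : ℝ, 0 < δ → ∃ γ : ℝ, 0 < γ ∧ ∀ v ∈ Box γ k,
        |(oneLoopSplit_betaOfMerged (betaMerged F (mergedTermFamilyMatT F 2 (TcanOfRecord F 2) (chiFixed29 F 2 θ.ν θ.ε₂₉) θ.εbg) θ.ρ8 θ.bV)
            (beta0OfMerged (betaMerged F (mergedTermFamilyMatT F 2 (TcanOfRecord F 2) (chiFixed29 F 2 θ.ν θ.ε₂₉) θ.εbg) θ.ρ8 θ.bV) θ.v₀) θ.γ).β1 k v| ≤ δ) ↔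
      ∀ k : ℕ, Tendsto (betaMerged F (mergedTermFamilyMatT F 2 (TcanOfRecord F 2) (chiFixed29 F 2 θ.ν θ.ε₂₉) θ.εbg) θ.ρ8 θ.bV k)
        (Filter.pi fun _ : Fin (k + 1) => 𝓝[>] (0 : ℝ))
        (𝓝 (beta0OfMerged (betaMerged F (mergedTermFamilyMatT F 2 (TcanOfRecord F 2) (chiFixed29 F 2 θ.ν θ.ε₂₉) θ.εbg) θ.ρ8 θ.bV) θ.v₀ k)) :=
  anchor_record_iff_forall_tendsto_pi θ hθ.toStage9.gamma_pos

/-- `N = 2`: the body of `ContRecord13` at `(F, θ, hP)` ⟺ ∀ k, `ContinuousOn (β_m k) (]0, θ.γ]^{k+1})`. [cite: Balaban1987RG1, §1 p.264 (elementary reformulation)] -/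
theorem contRecord13Body₂_iff (θ : Stage13HParams F 2) :
    letI := θ.instVβ₁; letI := θ.instVβ₂; letI := θ.instιβ
    BetaContH θ.γ
        (betaOfMerged (betaMerged F (mergedTermFamilyMatT F 2 (TcanOfRecord F 2) (chiFixed29 F 2 θ.ν θ.ε₂₉) θ.εbg) θ.ρ8 θ.bV)
          (beta0OfMerged (betaMerged F (mergedTermFamilyMatT F 2 (TcanOfRecord F 2) (chiFixed29 F 2 θ.ν θ.ε₂₉) θ.εbg) θ.ρ8 θ.bV) θ.v₀) θ.γ) ↔
      ∀ k : ℕ, ContinuousOn (betaMerged F (mergedTermFamilyMatT F 2 (TcanOfRecord F 2) (chiFixed29 F 2 θ.ν θ.ε₂₉) θ.εbg) θ.ρ8 θ.bV k) (Box θ.γ k) :=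
  cont_record_iff_forall_continuousOn θ

end Two

end Summit.QuantumFields.YangMills.Theorems.BalabanUVNodesK2Line2RungsAllScales

end
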